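import Summits.ResolutionOfSingularities.ResolutionOfSingularities.Theorems.StallVertexCompanion6
import HarnessLib

/-!
# StallVertexCompanion7 — decomp-res node «StallVertexCompanion (lens-5 g29, rev 10 of the node «StallVertex»;
critic row 192 CLEARED +1)», tree file 7/8 of the node

Content from the decomp-res lens-5 g29 node file `HOME/decomp-res-lens-5/g29/StallVertexCompanion.lean` (pin
deaa8fea) with the critic's ten mechanical lint fixes (fixed sha256 245dae5b; HOME =
run/shared/lean/pub/decomp-res); critic CRITIC-LEDGER row 192 CLEARED +1 — provenance, the fix list, critic text and
the lens header in full in part 2 of the node, `StallVertexCompanion`.  Namespace `…Theorems.StallVertex`;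
`--supports stmt-ResolutionOfSingularities-31770`.

## This file

Continuation 7/8 of `StallVertexCompanion` (same namespace and sections of the node, cut at the tree's 400-line cap;
section variables / opens replayed): `section WalkTangent` — carries `tangentAt_of_staysOnNewest`.

[WRITER NOTE (decomp-res writer g12): file split only (tree files ≤ 400 lines) plus the ten critic-ordered lint
fixes listed in `StallVertexCompanion`; namespace, sections, section variables / opens / `set_option maxHeartbeats …
in` lines and every declaration otherwise exactly as in the lens.]

(Sources: KawanoueMatsuki2012 arXiv:1205.4556 Prop. 3 (the companion (c_{f,𝕆}·𝕄^{-a}, μ̃·a)); Moh1987; Hauser2010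
(kangaroo points); HauserPerlega2019 §2; HauserPerlega2024; CossartPiltant2008 §2; CossartJannsenSaito2020 Ch. 8;
Benito–Villamayor (monomial case); Hironaka2005.)
-/

noncomputable section

open MvPolynomial Finset
open Literature.AlgebraicGeometry.Resolution
open Literature.AlgebraicGeometry.Resolution.Hauser2010
open Literature.AlgebraicGeometry.Resolution.HauserPerlega2024
open Literature.Barriers.ResolutionOfSingularities
open Literature.AlgebraicGeometry.Resolution.PointBlowup
open Summit.ResolutionOfSingularities.ResolutionOfSingularities.Theses
open Summit.ResolutionOfSingularities.ResolutionOfSingularities.Theorems.TightDefectClasses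
open Summit.ResolutionOfSingularities.ResolutionOfSingularities.Theorems.ProximityCut
open Summit.ResolutionOfSingularities.ResolutionOfSingularities.Theorems.ExitLaw
open Summit.ResolutionOfSingularities.ResolutionOfSingularities.Theorems.DifferentialShade

namespace Summit.ResolutionOfSingularities.ResolutionOfSingularities.Theorems.StallVertex

section WalkTangent

variable {K : Type} [Field K] [DecidableEq K]

set_option maxHeartbeats 2000000 in
/-- **T2 — STAYS-ON-NEWEST FORCES TANGENCY.**  If move `t + 1` changes chart (`j_{t+1} ≠ j_t`) without translating
the previous chart letter (`b_{t+1}(j_t) = 0`) — the walk STAYS ON THE NEWEST exceptional divisor — then the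
persisting minimiser is TANGENT at `t`: the low layer of its carried cone is rigidified by the attained move `t + 1`
(`low_layer_of_staysOnNewest`, three letters) and the attained move `t` rebuilds the cone from it
(`cone_of_low_layer`); positivity `μ̃ > 0` (`youngExp_degree_lt`) makes the pure power non-trivial. [new] [folklore] -/
theorem tangentAt_of_staysOnNewest {p e : ℕ} (hp : p.Prime) [CharP K p] {s₀ : State (Fin 3) K}
    (hs : IsRoot (p ^ e) s₀) (W : ForcedWalk (p ^ e) s₀) (N : ℕ)
    (hstall : ∀ t, N ≤ t → (ifp W (t + 1)).muTilde (p ^ e) = (ifp W t).muTilde (p ^ e))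
    (hskew : ∀ (k : Fin 3) (N' : ℕ), ∃ t, N' ≤ t ∧ (W.j t = k ∨ W.b t k ≠ 0))
    (hpos : (0 : WithTop ℚ) < (ifp W N).muTilde (p ^ e)) {t : ℕ} (ht : N ≤ t) (hnew : StaysOnNewest W t)
    {J₀ : Fin 3 →₀ ℕ} (hJ₀ : J₀ ∈ (ifp W t).idx)
    (hμ : (ifp W t).muP (p ^ e) = levelRatio (ordZero ((ifp W t).gen J₀)) (p ^ e - J₀.degree)) :
    TangentAt W t J₀ := by
  classical
  have hst := hstall t ht
  have hg₀ne := gen_ne_zero_of_minimiser hp hs W t hμ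
  obtain ⟨d₀, hd₀⟩ := exists_ordZero_eq_natCast hg₀ne
  have hledger := stall_ledger (p ^ e) (W.j t) (W.b t) (W.onExc t) (ifp W t) (fun J hJ => (level_bounds W t J hJ).2)
    (sing_ifp hp hs W t) (by rw [← ifp_succ]; exact hst.symm.le) hJ₀ hμ hd₀
  have hrig := stall_rigid (p ^ e) (W.j t) (W.b t) (W.onExc t) (ifp W t) (fun J hJ => (level_bounds W t J hJ).2)
    (sing_ifp hp hs W t) (by rw [← ifp_succ]; exact hst.symm.le) hJ₀ hμ hd₀
  obtain ⟨hJ₀', hμ'⟩ := minimiser_succ hp hs W t hst hJ₀ hμ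
  have hflat := flat_law hp hs W N hstall hskew
  have ha0 : 0 < p ^ e - J₀.degree := by have := (level_bounds W t J₀ hJ₀).2; omega
  -- abbreviations
  set a := p ^ e - J₀.degree with ha
  set j := W.j t with hj
  set b := W.b t with hb
  have hbj : b j = 0 := W.onExc t
  set G := (ifp W t).gen J₀ with hG
  set n := (ordZero (dirForm d₀ j b G)).toNat with hn
  have hTn : ordZero (dirForm d₀ j b G) = n := (coe_toNat_ordZero (dirForm_ne_zero j b hd₀)).symm
  have had₀ : a ≤ d₀ := by
    have := sing_ifp hp hs W t J₀ hJ₀ hg₀ne; rw [hd₀] at this; exact_mod_cast this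
  have hgen : (ifp W (t + 1)).gen J₀ = PointBlowup.translate b (chartTransform a j G) := by rw [ifp_succ]; rfl
  have hord2 : ordZero ((ifp W (t + 1)).gen J₀) = ((d₀ - a + n : ℕ) : ℕ∞) := by rw [ifp_succ]; exact hrig.2.1
  have hg'ne : (ifp W (t + 1)).gen J₀ ≠ 0 := gen_ne_zero_of_minimiser hp hs W (t + 1) hμ'
  -- the young letters at `t + 1` are `j` and the kept young letters of `t`
  have hyoung' : (ifp W (t + 1)).young = insert j ((ifp W t).young.filter fun i => b i = 0) := by rw [ifp_succ]; rfl
  have hjy' : j ∈ (ifp W (t + 1)).young := by rw [hyoung']; exact Finset.mem_insert_self _ _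
  have hkept' : ∀ i ∈ (ifp W (t + 1)).young, i ≠ j → i ∈ (ifp W t).young ∧ b i = 0 := by
    intro i hi hij
    rw [hyoung', Finset.mem_insert] at hi
    rcases hi with h | h
    · exact absurd h hij
    · exact Finset.mem_filter.mp h
  -- `n ≥ 1`
  have hpos_t : (0 : WithTop ℚ) < (ifp W t).muTilde (p ^ e) := by rw [muTilde_eq_of_stall W hstall ht]; exact hpos
  have hn0 : n ≠ 0 := by
    intro h0
    apply ordZero_dirForm_ne_zero_of_stall_pos (p ^ e) j b hbj (ifp W t) (fun J hJ => (level_bounds W t J hJ).2)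
      (sing_ifp hp hs W t) (by rw [← ifp_succ]; exact hst.symm.le) hpos_t hJ₀ hμ hd₀
    rw [hTn, h0, Nat.cast_zero]
  obtain ⟨m₁, hm₁⟩ : ∃ m₁, m₁ + 1 = n := ⟨n - 1, by omega⟩
  -- the two-layer form of `in(g_{t+1})`
  set A := homogeneousComponent n (dirForm d₀ j b G) with hA
  set B := homogeneousComponent m₁ (tailForm d₀ j b G) with hB
  have hAne : A ≠ 0 := homogeneousComponent_ne_zero_of_ordZero_eq hTn
  have hAfree : ∀ e' ∈ A.support, e' j = 0 :=
    fun e' he' => dirForm_free d₀ b hbj G e' (mem_support_of_mem_support_homogeneousComponent he')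
  have hlayer : homogeneousComponent (d₀ - a + n) ((ifp W (t + 1)).gen J₀) = X j ^ (d₀ - a) * (A + X j * B) := by
    rw [hgen, move_eq_layer b hbj had₀ hd₀, homogeneousComponent_X_pow_mul, map_add]
    congr 2
    have h1 := homogeneousComponent_X_pow_mul j 1 m₁ (tailForm d₀ j b G)
    rw [pow_one, add_comm, hm₁] at h1
    exact h1
  -- the kept young letters keep their divisor orders (flat law at `t` and `t+1`, `stall_ledger` (6))
  have hεkept : ∀ i ∈ (ifp W (t + 1)).young, i ≠ j →
      (divisorOrder i ((ifp W (t + 1)).gen J₀)).toNat = (divisorOrder i G).toNat := by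
    intro i hi hij
    obtain ⟨hiy, hbi⟩ := hkept' i hi hij
    have h6 := hledger.1 i hiy hij hbi
    rw [← ifp_succ] at h6
    have hf' := hflat (t + 1) (by omega) J₀ hJ₀' hμ' i hi
    have hf := hflat t ht J₀ hJ₀ hμ i hiy
    unfold NondefAt at hf hf'
    rw [h6, hf, ← ENat.coe_toNat (divisorOrder_ne_top (i := i) hg₀ne),
      ← ENat.coe_toNat (divisorOrder_ne_top (i := i) hg'ne)] at hf'
    exact (levelRatio_natCast_inj ha0 hf').symm
  -- the attained data of move `t` (`stall_ledger` (8))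
  set ε : Fin 3 → ℕ := fun i => (divisorOrder i G).toNat with hε
  set S : Finset (Fin 3) := (ifp W t).young.filter fun i => b i ≠ 0 with hSdef
  have hjS : j ∉ S := by rw [hSdef, Finset.mem_filter, not_and, not_not]; exact fun _ => hbj
  set sx : Fin 3 →₀ ℕ := ∑ i ∈ S, Finsupp.single i (ε i) with hsx
  have hsx_apply : ∀ i, sx i = if i ∈ S then ε i else 0 := by
    intro i
    rw [hsx, Finsupp.coe_finsetSum, Finset.sum_apply]
    simp_rw [Finsupp.single_apply]
    exact Finset.sum_ite_eq' S i ε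
  set kx : ℕ := if j ∈ (ifp W t).young then ε j else 0 with hkx
  have hεle : ∀ e' ∈ G.support, ∀ i, ε i ≤ e' i := fun e' he' i => by
    have h := divisorOrder_le_exponent (i := i) he'
    rw [← ENat.coe_toNat (divisorOrder_ne_top (i := i) hg₀ne)] at h
    exact_mod_cast h
  have hGx : ∀ e' ∈ G.support, sx ≤ e' ∧ kx ≤ e' j := by
    intro e' he'
    refine ⟨fun i => ?_, ?_⟩
    · rw [hsx_apply]
      split_ifs
      · exact hεle e' he' i
      · exact Nat.zero_le _
    · rw [hkx]
      split_ifs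
      · exact hεle e' he' j
      · exact Nat.zero_le _
  have hsxj : sx j = 0 := by rw [hsx_apply, if_neg hjS]
  have hsxb : ∀ i, sx i ≠ 0 → b i ≠ 0 := by
    intro i hi
    rw [hsx_apply] at hi
    split_ifs at hi with h
    · exact (Finset.mem_filter.mp h).2
    · exact absurd rfl hi
  have hatt : n + (sx.degree + kx) = d₀ := hledger.2.2
  -- the data of move `t + 1`
  have hst' := hstall (t + 1) (by omega)
  set j' := W.j (t + 1) with hj'
  set b' := W.b (t + 1) with hb'
  have hjj' : j' ≠ j := hnew.1
  have hb'j : b' j = 0 := hnew.2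
  have hb'j' : b' j' = 0 := W.onExc (t + 1)
  have hledger' := stall_ledger (p ^ e) j' b' hb'j' (ifp W (t + 1)) (fun J hJ => (level_bounds W (t + 1) J hJ).2)
    (sing_ifp hp hs W (t + 1)) (by rw [← ifp_succ]; exact hst'.symm.le) hJ₀' hμ' hord2
  set n' := (ordZero (dirForm (d₀ - a + n) j' b' ((ifp W (t + 1)).gen J₀))).toNat with hn'
  have hTn' : ordZero (dirForm (d₀ - a + n) j' b' ((ifp W (t + 1)).gen J₀)) = n' :=
    (coe_toNat_ordZero (dirForm_ne_zero j' b' hord2)).symm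
  -- the third letter
  obtain ⟨c, hcj, hcj'⟩ : ∃ c : Fin 3, c ≠ j ∧ c ≠ j' := by
    have key : ∀ x y : Fin 3, ∃ c : Fin 3, c ≠ x ∧ c ≠ y := by decide
    exact key j j'
  have hσ : ∀ i : Fin 3, i = j ∨ i = j' ∨ i = c := by
    have key : ∀ (x y z : Fin 3), y ≠ x → z ≠ x → z ≠ y → ∀ i : Fin 3, i = x ∨ i = y ∨ i = z := by decide
    exact key j j' c hjj' hcj hcj'
  have three : ∀ f : Fin 3 →₀ ℕ, f.degree = f j + f j' + f c := by
    intro f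
    have hf : f = Finsupp.single j (f j) + Finsupp.single j' (f j') + Finsupp.single c (f c) := by
      ext i
      simp only [Finsupp.add_apply, Finsupp.single_apply]
      rcases hσ i with rfl | rfl | rfl
      · rw [if_pos rfl, if_neg hjj', if_neg hcj]; omega
      · rw [if_neg hjj'.symm, if_pos rfl, if_neg hcj']; omega
      · rw [if_neg (fun h => hcj h.symm), if_neg (fun h => hcj' h.symm), if_pos rfl]; omega
    conv_lhs => rw [hf]
    rw [map_add, map_add, Finsupp.degree_single, Finsupp.degree_single, Finsupp.degree_single]
  -- the attained data of move `t + 1` (`stall_ledger` (8) at `t + 1`)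
  set ε' : Fin 3 → ℕ := fun i => (divisorOrder i ((ifp W (t + 1)).gen J₀)).toNat with hε'
  set S' : Finset (Fin 3) := (ifp W (t + 1)).young.filter fun i => b' i ≠ 0 with hS'def
  have hj'S' : j' ∉ S' := by rw [hS'def, Finset.mem_filter, not_and, not_not]; exact fun _ => hb'j'
  set s' : Fin 3 →₀ ℕ := ∑ i ∈ S', Finsupp.single i (ε' i) with hs'
  have hs'_apply : ∀ i, s' i = if i ∈ S' then ε' i else 0 := by
    intro i
    rw [hs', Finsupp.coe_finsetSum, Finset.sum_apply]
    simp_rw [Finsupp.single_apply]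
    exact Finset.sum_ite_eq' S' i ε'
  set k' : ℕ := if j' ∈ (ifp W (t + 1)).young then ε' j' else 0 with hk'
  have hε'le : ∀ e' ∈ ((ifp W (t + 1)).gen J₀).support, ∀ i, ε' i ≤ e' i := fun e' he' i => by
    have h := divisorOrder_le_exponent (i := i) he'
    rw [← ENat.coe_toNat (divisorOrder_ne_top (i := i) hg'ne)] at h
    exact_mod_cast h
  have hG'x : ∀ e' ∈ ((ifp W (t + 1)).gen J₀).support, s' ≤ e' ∧ k' ≤ e' j' := by
    intro e' he'
    refine ⟨fun i => ?_, ?_⟩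
    · rw [hs'_apply]
      split_ifs
      · exact hε'le e' he' i
      · exact Nat.zero_le _
    · rw [hk']
      split_ifs
      · exact hε'le e' he' j'
      · exact Nat.zero_le _
  have hs'j' : s' j' = 0 := by rw [hs'_apply, if_neg hj'S']
  have hs'b : ∀ i, s' i ≠ 0 → b' i ≠ 0 := by
    intro i hi
    rw [hs'_apply] at hi
    split_ifs at hi with h
    · exact (Finset.mem_filter.mp h).2
    · exact absurd rfl hi
  have hatt' : n' + (s'.degree + k') = d₀ - a + n := hledger'.2.2
  -- A1′: the low layer is rigid
  have hA' : ∀ e' ∈ A.support, e'.degree = n ∧ e' j = 0 :=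
    fun e' he' => ⟨degree_eq_of_mem_support_homogeneousComponent he', hAfree e' he'⟩
  obtain ⟨lam, hlam0, hkn, hAeq⟩ := low_layer_of_staysOnNewest hjj' hcj hcj' hσ b' hb'j' hb'j hord2 rfl hlayer
    hAne hA' s' hs'j' hs'b k' hG'x hTn' hatt'
  -- A3: rebuild the cone at `t`
  set l : Fin 3 → K := fun i => if i = c then (1 : K) else if i = j' then -(b' c) else 0 with hl
  have hlj : l j = 0 := by
    show (if j = c then (1 : K) else if j = j' then -(b' c) else 0) = 0
    rw [if_neg (fun h => hcj h.symm), if_neg (fun h => hjj' h.symm)]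
  have hlc : l c = 1 := by show (if c = c then (1 : K) else if c = j' then -(b' c) else 0) = 1; rw [if_pos rfl]
  have hlj'v : l j' = -(b' c) := by
    show (if j' = c then (1 : K) else if j' = j' then -(b' c) else 0) = _; rw [if_neg hcj'.symm, if_pos rfl]
  have hlne : ∃ i, l i ≠ 0 := ⟨c, by rw [hlc]; exact one_ne_zero⟩
  set m : Fin 3 →₀ ℕ := Finsupp.single j' k' + Finsupp.single c (s' c) with hmdef
  have hmj : m j = 0 := by
    rw [hmdef, Finsupp.add_apply, Finsupp.single_eq_of_ne hjj'.symm, Finsupp.single_eq_of_ne hcj.symm, add_zero]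
  have hmj' : m j' = k' := by
    rw [hmdef, Finsupp.add_apply, Finsupp.single_eq_same, Finsupp.single_eq_of_ne hcj'.symm, add_zero]
  have hmc : m c = s' c := by
    rw [hmdef, Finsupp.add_apply, Finsupp.single_eq_of_ne hcj', Finsupp.single_eq_same, zero_add]
  have hk'young : k' ≠ 0 → j' ∈ (ifp W (t + 1)).young := by
    intro hk; by_contra h; exact hk (by rw [hk', if_neg h])
  have hs'cS : s' c ≠ 0 → c ∈ S' := by
    intro hc; by_contra h; exact hc (by rw [hs'_apply, if_neg h])
  have hm : ∀ i, m i ≠ 0 → i ≠ j ∧ b i = 0 := by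
    intro i hi
    rcases hσ i with h | h | h
    · rw [h, hmj] at hi; exact absurd rfl hi
    · rw [h] at hi ⊢; rw [hmj'] at hi; exact ⟨hjj', (hkept' _ (hk'young hi) hjj').2⟩
    · rw [h] at hi ⊢; rw [hmc] at hi; exact ⟨hcj, (hkept' c (Finset.mem_filter.mp (hs'cS hi)).1 hcj).2⟩
  have hA3 := cone_of_low_layer j b hbj hd₀ sx hsxj hsxb kx hGx hTn hatt m hm hlam0 l hlj hlne (n - k' - s' c) hAeq
  -- degrees
  set w := n - k' - s' c with hw
  set M := m + sx + Finsupp.single j kx with hM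
  set ρ := lam * (∏ i, b i ^ (sx i))⁻¹ with hρdef
  have hρ : ρ ≠ 0 := by
    refine mul_ne_zero hlam0 (inv_ne_zero (Finset.prod_ne_zero_iff.mpr fun i _ => ?_))
    by_cases hsi : sx i = 0
    · rw [hsi, pow_zero]; exact one_ne_zero
    · exact pow_ne_zero _ (hsxb i hsi)
  set l₁ : Fin 3 → K := Function.update l j (-(∑ i, l i * b i)) with hl₁
  have hdegM : M.degree + w = d₀ := by
    have h1 : (monomial M ρ * (∑ i, C (l₁ i) * X i) ^ w).IsHomogeneous (M.degree + w) :=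
      (isHomogeneous_monomial _ rfl).mul (by simpa using (isHomogeneous_linear l₁).pow w)
    have h2 : (monomial M ρ * (∑ i, C (l₁ i) * X i) ^ w).IsHomogeneous d₀ := by
      rw [← hA3]; exact homogeneousComponent_isHomogeneous d₀ _
    refine h1.inj_right h2 ?_
    rw [← hA3]; exact homogeneousComponent_ne_zero_of_ordZero_eq hd₀
  have hYlt := youngExp_degree_lt hp hs W N hstall hskew hpos ht hJ₀ hμ hd₀
  -- the exponent agrees with the young exponent at `j` and `j'`
  have hMj : M j = youngExp W t J₀ j := by
    rw [hM, Finsupp.add_apply, Finsupp.add_apply, hmj, hsxj, Finsupp.single_eq_same, youngExp_apply, hkx, zero_add,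
      zero_add]
  have hnot_young' : ∀ i, i ≠ j → ¬ (i ∈ (ifp W t).young ∧ b i = 0) → i ∉ (ifp W (t + 1)).young :=
    fun i hij h hi => h (hkept' i hi hij)
  have hMj' : M j' = youngExp W t J₀ j' := by
    rw [hM, Finsupp.add_apply, Finsupp.add_apply, hmj', hsx_apply, Finsupp.single_eq_of_ne hjj', add_zero,
      youngExp_apply, hk']
    by_cases hy : j' ∈ (ifp W t).young
    · rw [if_pos hy]
      by_cases hbj'0 : b j' = 0
      · have hy' : j' ∈ (ifp W (t + 1)).young := by
          rw [hyoung']; exact Finset.mem_insert_of_mem (Finset.mem_filter.mpr ⟨hy, hbj'0⟩)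
        rw [if_pos hy', if_neg (by rw [hSdef, Finset.mem_filter, not_and, not_not]; exact fun _ => hbj'0), add_zero]
        exact hεkept j' hy' hjj'
      · rw [if_neg (hnot_young' j' hjj' (fun h => hbj'0 h.2)), zero_add,
          if_pos (by rw [hSdef, Finset.mem_filter]; exact ⟨hy, hbj'0⟩)]
    · rw [if_neg hy, if_neg (hnot_young' j' hjj' (fun h => hy h.1)), zero_add, if_neg]
      rw [hSdef, Finset.mem_filter, not_and]; exact fun h => absurd h hy
  by_cases hB : c ∈ (ifp W t).young ∧ b c = 0 ∧ b' c = 0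
  · -- CASE B: the next move is a bare chart change; the cone is a monomial, the tangent line is `u_c`
    obtain ⟨hcy, hbc, hb'c⟩ := hB
    have hl0 : ∀ i, i ≠ c → l i = 0 := by
      intro i hic
      rcases hσ i with rfl | rfl | rfl
      · exact hlj
      · rw [hlj'v, hb'c, neg_zero]
      · exact absurd rfl hic
    have hsum0 : ∑ i, l i * b i = 0 :=
      Finset.sum_eq_zero fun i _ => by
        by_cases hic : i = c
        · rw [hic, hbc, mul_zero]
        · rw [hl0 i hic, zero_mul]
    have hl₁eq : l₁ = l := by
      rw [hl₁, hsum0, neg_zero]; exact Function.update_eq_self_iff.mpr hlj.symm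
    have hLc : (∑ i, C (l i) * X i : MvPolynomial (Fin 3) K) = X c := by
      rw [Finset.sum_eq_single c (fun i _ hic => by rw [hl0 i hic, C_0, zero_mul])
        (fun h => absurd (Finset.mem_univ c) h), hlc, C_1, one_mul]
    set w' := d₀ - (youngExp W t J₀).degree with hw'
    have hw'pos : 0 < w' := by omega
    have hYw' : (youngExp W t J₀).degree + w' = d₀ := by omega
    have hexp : M + Finsupp.single c w = youngExp W t J₀ + Finsupp.single c w' := by
      have h3M := three M
      have h3Y := three (youngExp W t J₀)
      ext i
      rw [Finsupp.add_apply M (Finsupp.single c w) i, Finsupp.add_apply (youngExp W t J₀) (Finsupp.single c w') i]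
      rcases hσ i with h | h | h <;> rw [h]
      · rw [Finsupp.single_eq_of_ne hcj.symm, Finsupp.single_eq_of_ne hcj.symm, hMj]
      · rw [Finsupp.single_eq_of_ne hcj'.symm, Finsupp.single_eq_of_ne hcj'.symm, hMj']
      · rw [Finsupp.single_eq_same, Finsupp.single_eq_same]; omega
    refine ⟨ρ, l, w', hρ, hw'pos, by rw [hYw', hd₀], ?_, ?_⟩
    · rw [hYw', hA3, hl₁eq, hLc, X_pow_eq_monomial, X_pow_eq_monomial, monomial_mul, monomial_mul, mul_one, hexp]
    · refine Finset.sum_eq_zero fun i _ => ?_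
      by_cases hic : i = c
      · rw [hic, Function.update_of_ne hcj, show W.b t c = 0 from hbc, mul_zero]
      · rw [hl0 i hic, zero_mul]
  · -- CASE A: the exponent is the young exponent
    have hMc : M c = youngExp W t J₀ c := by
      rw [hM, Finsupp.add_apply, Finsupp.add_apply, hmc, hsx_apply, Finsupp.single_eq_of_ne hcj, add_zero,
        youngExp_apply, hs'_apply]
      by_cases hcy : c ∈ (ifp W t).young
      · rw [if_pos hcy]
        by_cases hbc : b c = 0
        · have hb'c : b' c ≠ 0 := fun h => hB ⟨hcy, hbc, h⟩
          have hcy' : c ∈ (ifp W (t + 1)).young := by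
            rw [hyoung']; exact Finset.mem_insert_of_mem (Finset.mem_filter.mpr ⟨hcy, hbc⟩)
          rw [if_pos (Finset.mem_filter.mpr ⟨hcy', hb'c⟩),
            if_neg (by rw [hSdef, Finset.mem_filter, not_and, not_not]; exact fun _ => hbc), add_zero]
          exact hεkept c hcy' hcj
        · rw [if_neg (fun h => (hnot_young' c hcj (fun h' => hbc h'.2)) (Finset.mem_filter.mp h).1), zero_add,
            if_pos (by rw [hSdef, Finset.mem_filter]; exact ⟨hcy, hbc⟩)]
      · rw [if_neg hcy, if_neg (fun h => (hnot_young' c hcj (fun h' => hcy h'.1)) (Finset.mem_filter.mp h).1),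
          zero_add, if_neg]
        rw [hSdef, Finset.mem_filter, not_and]; exact fun h => absurd h hcy
    have hexp : M = youngExp W t J₀ := by
      ext i
      rcases hσ i with rfl | rfl | rfl
      · exact hMj
      · exact hMj'
      · exact hMc
    have hwpos : 0 < w := by rw [hexp] at hdegM; omega
    refine ⟨ρ, l₁, w, hρ, hwpos, by rw [← hexp, hdegM, hd₀], by rw [← hexp, hdegM, hA3], ?_⟩
    -- the rehomogenised plane passes through the direction
    rw [← Finset.add_sum_erase _ _ (Finset.mem_univ j), hl₁, Function.update_self, Function.update_self, mul_one,
      ← Finset.add_sum_erase _ _ (Finset.mem_univ j), hlj, zero_mul, zero_add]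
    rw [show ∑ i ∈ Finset.univ.erase j, Function.update l j (-(∑ i ∈ Finset.univ.erase j, l i * b i)) i *
        Function.update b j 1 i = ∑ i ∈ Finset.univ.erase j, l i * b i from Finset.sum_congr rfl fun i hi => by
          have hij : i ≠ j := Finset.ne_of_mem_erase hi
          rw [Function.update_of_ne hij, Function.update_of_ne hij]]
    ring

end WalkTangent

end Summit.ResolutionOfSingularities.ResolutionOfSingularities.Theorems.StallVertex
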